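import Summits.QuantumFields.BalabanUV.Beta.D1BFx.KGramCovJets
import Summits.QuantumFields.BalabanUV.Beta.D1BFx.CombFPWordArrays
import Summits.QuantumFields.BalabanUV.Beta.D1BFx.TorusGhostPairArrays

/-!
# `BalabanUV.Beta.D1BFx.KCombineCovTowers` — road «BF-x» for binder row D1, slot (K), (K) CLOSURE PLAN (R1-L) v0.2 §7: **THE TWO TOWER SLOTS OF THE
# COVARIANT ORGANISATION IN ARRAY CURRENCY, AND THEIR `ℤ⁴` LIMITS** — at TB4-W's jets and THE CONVENTION's gauge jets the «GRAM-COV» functional `bΦ` and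
# the «COMB-FP» functional `eτ` of `KCombineCov.identity_array_currency_cov_What0` (p251661) are the torus one-loop functionals of the LANDED fixed `ℤ⁴`
# families `Lgh`∕`Lgh₂` (this lineage's TB4-W 3b-gh, `TorusGhostWordArrays`∕`TorusGhostPairArrays`) against the composite ghost leg `(Cgh)^`, resp.
# `nFcol` (`CombFPWordArrays`) against the identity leg `(idK1)^`, and along the road's tori they CONVERGE to `hessKer (Cgh (m+1) a) Lgh Lgh₂ μ ν z`,
# resp. `hessKer idK1 nFcol nFcolMix μ ν z` by the sockets `tendsto_hessT_GPhi`∕`tendsto_hessT_Gtau` (p252994∕p253347) — so in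
# `KCombineCovCombLeg.hessKer_transfer_road_cov_Cgh_idK1` the tower families are PINNED: `𝒳Φ := Lgh`, `𝒳Φ₂ := Lgh₂`, `𝒳τ := nFcol`, `𝒳τ₂ := nFcolMix`

HONEST FRAMING (cell contract, verbatim): «discharging `BetaPertH` makes Bałaban's UV stability UNCONDITIONAL — a real constructive-QFT
result; it is NOT the continuum limit and NOT the Clay problem.»  HONEST DEPENDENCY (verbatim): «continuum YM on T⁴ ⇐ BetaPertH ∧ nine
spine estimates (0/9 proved); BetaPertH ⇐ (D1) ∧ (D4) ∧ CAP+tail; G-an2-4 gates asym, D1 and NE2/3/4.»  THIS MODULE DISCHARGES NOTHING of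
D1 ∕ BetaPertH: [folklore] compositions BY NAME (`KGramCovJets`, `CombFPWordArrays`, `TorusGhostWordArrays.Lsq_word_eq_perT`∕`biLoc_Lgh`,
`TorusGhostPairArrays.Lsq_pair_word_eq_perT`, `TorusGhostPairStencils.biLoc_Lgh₂`∕`torus_test_iff`∕`biLoc_zero_of_nonneg`, `KCombineCovLegs.tendsto_hessT_GPhi`,
`KCombineCovCombLeg.tendsto_hessT_Gtau`∕`hessKer_transfer_road_cov_Cgh_idK1`).  No `def`, no `def … : Prop`, nothing cited, 0 sorry.  DISPLAYED (unchanged):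
WARD-L `hE•` (Q1), the M∕N table dictionary and their BiLoc letters ((A2-M∕N)), `Spr (Ga (m+1) a)`, and the per-torus identity `hId` — whose two tower slots
are now literal torus functionals of pinned families.  NOT summit progress; NOT BetaPertH, NOT continuum, NOT Clay.

ABSOLUTE RULE (cell, verbatim): «No internally-minted statement may enter as a cited fact. Every hypothesis is either kernel-proved in this
package or a verbatim quotation of a PUBLISHED theorem with page reference. The manuscript(s) under audit are NOT citable for their own
disputed steps — they are the thing under adjudication; programme-internal (2001/route/tribunal) claims are never citable.»

CONTENT (all [folklore]; `s = (m+1)·p`, `σ = siteOf 4 s`, `b = (σu, μ)`, `b′ = (σu′, ν)`).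
* §1 `submatrix_fst_perT` (`(perT K)ᶠ = K^`), **`Lsq₁_fst_eq_arr`** (`((L̂²)_b)ᶠ = (arr s (Lgh μ u))^`), **`Lsq₁₁_fst_eq_arr`** (`((L̂²)_{bb′})ᶠ = (arr s (Lgh₂ μ u ν u′))^`, `|u−u′|₁ + 3 ≤ s`),
  **`hessT_gramCov_What0_eq_arr`** (the §3′ `bΦ` functional at TB4-W's jets + THE CONVENTION, under WARD-L, `= hessT ((Cgh (m+1) a)^; (arr Lgh μ u)^, (arr Lgh ν u′)^, (arr Lgh₂ μ u ν u′)^)`).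
* §2 `combFPMix_eq_of_lt` (torus test = `ℤ⁴` test for the mixed comb-FP word, `|u−u′|₁ < s`), `biLoc_nFcolMix`;
  **`tendsto_gramCov_tower`**, **`tendsto_combFP_tower`** — the two tower functionals along `Site 4 ((m+1)·p k)`, `p k → ∞`, at the base bonds `(μ,0)`, `(ν,z)`
  converge to `hessKer (Cgh (m+1) a) (Lgh) (Lgh₂) μ ν z` and `hessKer idK1 (nFcol) (nFcolMix) μ ν z`.
* §3 **`hessKer_transfer_road_cov_towers`** — `KCombineCov` §4 with the four tower families PINNED to `Lgh`∕`Lgh₂`∕`nFcol`∕`nFcolMix` and both tower sockets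
  discharged: `hessKer G_M 𝒱M 𝒲M + hessKer (Cgh (m+1) a) Lgh Lgh₂ = hessKer (NlegRoad m a) 𝒱N 𝒲N + 2·hessKer idK1 nFcol nFcolMix` at `μ ν z`, modulo `hId` (with these
  slots), the M∕N BiLoc letters and `Spr (Ga (m+1) a)`.
Unit `b2b-balaban-beta-d1-formalise-leaf-03` (gen 11); road owner `b2b-balaban-beta-d1-p2`.
-/

noncomputable section

namespace Summit.QuantumFields.BalabanUV.Beta.D1BFx.KCombineCovTowers

open Matrix Filter Topology
open scoped BigOperators
open Literature.MathematicalPhysics.QuantumFieldTheory.Balaban1983to89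
open Literature.MathematicalPhysics.QuantumFieldTheory.Balaban1983to89.Beta
open B12Sec2to5 (l1 l1_nonneg)
open ExpKernelCalculus (MKer Decays BiLoc hessKer)
open AffineAveraging (box toSite unitVec)
open OneStepResolventKernel (Fib)
open OneStepKernelFamily (KInvStep)
open Summit.QuantumFields.BalabanUV.Beta.TameKernelCalculus (Spr)
open Summit.QuantumFields.BalabanUV.Beta.AxialDressingRooted (coDressKBmAt)
open Summit.QuantumFields.BalabanUV.Beta.D1BFx.FibredPeriodisation (periodiseF periodiseF_apply)
open Summit.QuantumFields.BalabanUV.Beta.D1BFx.SortedKernels (blocksHat)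
open Summit.QuantumFields.BalabanUV.Beta.D1BFx.SortedPack (sortK)
open Summit.QuantumFields.BalabanUV.Beta.D1BFx.SortedEmbedding (e₁)
open Summit.QuantumFields.BalabanUV.Beta.D1BFx.PeriodicArrays (arr toF)
open Summit.QuantumFields.BalabanUV.Beta.D1BFx.MixedVarPackedHess (hessT)
open Summit.QuantumFields.BalabanUV.Beta.D1BFx.GramWeightJets (gram₀ gram₁)
open Summit.QuantumFields.BalabanUV.Beta.D1BFx.GramWeightJetsMixed (gramMix)
open Summit.QuantumFields.BalabanUV.Beta.D1BFx.TorusCombKKT (I J CombRows tauT Khat Qhat)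
open Summit.QuantumFields.BalabanUV.Beta.D1BFx.TorusGaugeBasis (What0)
open Summit.QuantumFields.BalabanUV.Beta.D1BFx.TorusGaugeBasisMatrix (Nhat)
open Summit.QuantumFields.BalabanUV.Beta.D1BFx.PeriodisedProjector (Lhat)
open Summit.QuantumFields.BalabanUV.Beta.D1BFx.TorusCoframeJets (Djet Tjet₀ Tjet₁ Tjet₁₁ Ajet₀ Ajet₁ Ajet₁₁)
open Summit.QuantumFields.BalabanUV.Beta.D1BFx.TorusWeightJetsCombFree (Lsq₁ Lsq₁₁)
open Summit.QuantumFields.BalabanUV.Beta.D1BFx.RWeightedLegPack (NlegRoad)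
open Summit.QuantumFields.BalabanUV.Beta.D1BFx.GaugeJetLocal (idK1)
open Summit.QuantumFields.BalabanUV.Beta.D1BFx.KGhostLeg (Cgh)
open Summit.QuantumFields.BalabanUV.Beta.D1BFx.TorusGhostWordArrays (perT Lgh Lsq_word_eq_perT biLoc_Lgh)
open Summit.QuantumFields.BalabanUV.Beta.D1BFx.TorusGhostPairStencils (Lgh₂ biLoc_Lgh₂ torus_test_iff biLoc_zero_of_nonneg)
open Summit.QuantumFields.BalabanUV.Beta.D1BFx.TorusGhostPairArrays (Lsq_pair_word_eq_perT)
open Summit.QuantumFields.BalabanUV.Beta.D1BFx.KCombineCovLegs (tendsto_hessT_GPhi)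
open Summit.QuantumFields.BalabanUV.Beta.D1BFx.KCombineCovCombLeg (tendsto_hessT_Gtau hessKer_transfer_road_cov_Cgh_idK1)
open Summit.QuantumFields.BalabanUV.Beta.D1BFx.KGramCovJets (hessT_gramCov_What0_eq_Gjet hessT_Gjet_eq_Cgh_Lsq)
open Summit.QuantumFields.BalabanUV.Beta.D1BFx.CombFPWordArrays (nFcol biLoc_nFcol)

/-! ## §1 The «GRAM-COV» slot in array currency -/

section Phi

variable (s : ℕ) [NeZero s]

/-- [folklore] The `Unit`-fibre round trip: `(perT K)ᶠ = K^`. -/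
theorem submatrix_fst_perT (K : MKer 4 Unit) :
    (perT s K).submatrix Prod.fst Prod.fst = Matrix.of (periodiseF s (toF K)) := by
  ext ⟨x, a⟩ ⟨z, b⟩
  rfl

/-- [folklore] **`((L̂²)_b)ᶠ = (arr s (Lgh μ u))^`** at `b = (σu, μ)` (`TorusGhostWordArrays.Lsq_word_eq_perT`). -/
theorem Lsq₁_fst_eq_arr (μ : Fin 4) (u : Fin 4 → ℤ) :
    (Lsq₁ s (siteOf 4 s u, μ)).submatrix Prod.fst Prod.fst = Matrix.of (periodiseF s (toF (arr s (Lgh μ u)))) := by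
  rw [Lsq₁, Lsq_word_eq_perT, submatrix_fst_perT]

/-- [folklore] **`((L̂²)_{bb′})ᶠ = (arr s (Lgh₂ μ u ν u′))^`** at `b = (σu, μ)`, `b′ = (σu′, ν)`, for `|u−u′|₁ + 3 ≤ s` (`TorusGhostPairArrays.Lsq_pair_word_eq_perT`). -/
theorem Lsq₁₁_fst_eq_arr (μ ν : Fin 4) (u u' : Fin 4 → ℤ) (hs : l1 (u - u') + 3 ≤ s) :
    (Lsq₁₁ s (siteOf 4 s u, μ) (siteOf 4 s u', ν)).submatrix Prod.fst Prod.fst = Matrix.of (periodiseF s (toF (arr s (Lgh₂ μ u ν u')))) := by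
  rw [Lsq₁₁, Lsq_pair_word_eq_perT s μ u ν u' hs, submatrix_fst_perT]

variable (m : ℕ) {a : ℝ} (p : ℕ) [NeZero p] {r : Fin 4 → ℕ}

/-- [folklore] **THE «GRAM-COV» FUNCTIONAL `bΦ` OF `KCombineCov` §3′ IN ARRAY CURRENCY.**  At TB4-W's jets (`B• = gram•(Tjet• N̂ e₁, Ajet• N̂)`, letters `hB•`),
THE CONVENTION's gauge jets at the torus images `b = (σu, μ)`, `b′ = (σu′, ν)` of two `ℤ⁴` bonds (letters `hW•`), under the WARD-L letters, and for
`|u − u′|₁ + 3 ≤ s = (m+1)·p`: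
`hessT ((gram₀ Ŵ₀ Y₀)⁻¹; gram₁ Ŵ₀ Wₛ Y₀ Yₛ, gram₁ Ŵ₀ Wₜ Y₀ Yₜ, gramMix …) = hessT ((Cgh (m+1) a)^; (arr s (Lgh μ u))^, (arr s (Lgh ν u′))^, (arr s (Lgh₂ μ u ν u′))^)`. -/
theorem hessT_gramCov_What0_eq_arr (ha : 0 < a) (hr : r ∈ box 4 (m + 1)) (μ ν : Fin 4) (u u' : Fin 4 → ℤ)
    (hs : l1 (u - u') + 3 ≤ (((m + 1) * p : ℕ) : ℝ))
    (Kₛ Kₜ Kₛₜ : Matrix (I 3 (m + 1) p) (I 3 (m + 1) p) ℝ)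
    {Wₛ Wₜ Wₛₜ : Matrix (I 3 (m + 1) p) (CombRows (toSite r) (m + 1) p) ℝ}
    (hWₛ : Wₛ = (Djet ((m + 1) * p) (siteOf 4 ((m + 1) * p) u, μ)).submatrix (e₁ (m + 1) p) id * Nhat r (m + 1) p)
    (hWₜ : Wₜ = (Djet ((m + 1) * p) (siteOf 4 ((m + 1) * p) u', ν)).submatrix (e₁ (m + 1) p) id * Nhat r (m + 1) p)
    (hWₛₜ : Wₛₜ = if (siteOf 4 ((m + 1) * p) u, μ) = (siteOf 4 ((m + 1) * p) u', ν)
      then (Djet ((m + 1) * p) (siteOf 4 ((m + 1) * p) u, μ)).submatrix (e₁ (m + 1) p) id * Nhat r (m + 1) p else 0)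
    (hEₛ : Kₛ * What0 r (m + 1) p + Khat (d := 3) (m + 1) p * Wₛ = 0) (hEₜ : Kₜ * What0 r (m + 1) p + Khat (d := 3) (m + 1) p * Wₜ = 0)
    (hEₛₜ : Kₛₜ * What0 r (m + 1) p + Kₛ * Wₜ + Kₜ * Wₛ + Khat (d := 3) (m + 1) p * Wₛₜ = 0)
    {B₀ Bₛ Bₜ Bₛₜ : Matrix (I 3 (m + 1) p) (I 3 (m + 1) p) ℝ}
    (hB₀ : B₀ = gram₀ (Tjet₀ ((m + 1) * p) (Nhat r (m + 1) p) (e₁ (m + 1) p)) (Ajet₀ ((m + 1) * p) (Nhat r (m + 1) p)))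
    (hBₛ : Bₛ = gram₁ (Tjet₀ ((m + 1) * p) (Nhat r (m + 1) p) (e₁ (m + 1) p))
      (Tjet₁ ((m + 1) * p) (siteOf 4 ((m + 1) * p) u, μ) (Nhat r (m + 1) p) (e₁ (m + 1) p))
      (Ajet₀ ((m + 1) * p) (Nhat r (m + 1) p)) (Ajet₁ ((m + 1) * p) (siteOf 4 ((m + 1) * p) u, μ) (Nhat r (m + 1) p)))
    (hBₜ : Bₜ = gram₁ (Tjet₀ ((m + 1) * p) (Nhat r (m + 1) p) (e₁ (m + 1) p))
      (Tjet₁ ((m + 1) * p) (siteOf 4 ((m + 1) * p) u', ν) (Nhat r (m + 1) p) (e₁ (m + 1) p))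
      (Ajet₀ ((m + 1) * p) (Nhat r (m + 1) p)) (Ajet₁ ((m + 1) * p) (siteOf 4 ((m + 1) * p) u', ν) (Nhat r (m + 1) p)))
    (hBₛₜ : Bₛₜ = gramMix (Tjet₀ ((m + 1) * p) (Nhat r (m + 1) p) (e₁ (m + 1) p))
      (Tjet₁ ((m + 1) * p) (siteOf 4 ((m + 1) * p) u, μ) (Nhat r (m + 1) p) (e₁ (m + 1) p))
      (Tjet₁ ((m + 1) * p) (siteOf 4 ((m + 1) * p) u', ν) (Nhat r (m + 1) p) (e₁ (m + 1) p))
      (Tjet₁₁ ((m + 1) * p) (siteOf 4 ((m + 1) * p) u, μ) (siteOf 4 ((m + 1) * p) u', ν) (Nhat r (m + 1) p) (e₁ (m + 1) p))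
      (Ajet₀ ((m + 1) * p) (Nhat r (m + 1) p)) (Ajet₁ ((m + 1) * p) (siteOf 4 ((m + 1) * p) u, μ) (Nhat r (m + 1) p))
      (Ajet₁ ((m + 1) * p) (siteOf 4 ((m + 1) * p) u', ν) (Nhat r (m + 1) p))
      (Ajet₁₁ ((m + 1) * p) (siteOf 4 ((m + 1) * p) u, μ) (siteOf 4 ((m + 1) * p) u', ν) (Nhat r (m + 1) p))) :
    hessT (gram₀ (What0 r (m + 1) p) (Khat (d := 3) (m + 1) p + B₀))⁻¹
        (gram₁ (What0 r (m + 1) p) Wₛ (Khat (d := 3) (m + 1) p + B₀) (Kₛ + Bₛ))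
        (gram₁ (What0 r (m + 1) p) Wₜ (Khat (d := 3) (m + 1) p + B₀) (Kₜ + Bₜ))
        (gramMix (What0 r (m + 1) p) Wₛ Wₜ Wₛₜ (Khat (d := 3) (m + 1) p + B₀) (Kₛ + Bₛ) (Kₜ + Bₜ) (Kₛₜ + Bₛₜ))
      = hessT (Matrix.of (periodiseF ((m + 1) * p) (toF (Cgh (m + 1) a))))
          (Matrix.of (periodiseF ((m + 1) * p) (toF (arr ((m + 1) * p) (Lgh μ u)))))
          (Matrix.of (periodiseF ((m + 1) * p) (toF (arr ((m + 1) * p) (Lgh ν u')))))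
          (Matrix.of (periodiseF ((m + 1) * p) (toF (arr ((m + 1) * p) (Lgh₂ μ u ν u'))))) := by
  rw [hessT_gramCov_What0_eq_Gjet m p ha hr _ _ Kₛ Kₜ Kₛₜ hWₛ hWₜ hWₛₜ hEₛ hEₜ hEₛₜ hB₀ hBₛ hBₜ hBₛₜ, hessT_Gjet_eq_Cgh_Lsq m p ha hr,
    Lsq₁_fst_eq_arr, Lsq₁_fst_eq_arr, Lsq₁₁_fst_eq_arr _ μ ν u u' hs]

end Phi

/-! ## §2 The pinned tower families and the two limits -/

section Towers

variable (m : ℕ) {a : ℝ} {r : Fin 4 → ℕ}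

/-- [folklore] **THE TORUS TEST IS THE `ℤ⁴` TEST** for the mixed comb-FP word once `|u − u′|₁ < s` (`TorusGhostPairStencils.torus_test_iff`). -/
theorem combFPMix_eq_of_lt (s : ℕ) [NeZero s] (μ ν : Fin 4) (u u' : Fin 4 → ℤ) (hs : l1 (u - u') < s) :
    (if (siteOf 4 s u, μ) = (siteOf 4 s u', ν) then nFcol r (m + 1) μ u else 0)
      = (if u = u' ∧ μ = ν then nFcol r (m + 1) μ u else 0) := by
  by_cases h : u = u' ∧ μ = ν
  · rw [if_pos h, if_pos ((torus_test_iff s μ ν hs).mpr h)]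
  · rw [if_neg h, if_neg (fun h' => h ((torus_test_iff s μ ν hs).mp h'))]

/-- [folklore] LOCALISATION OF THE MIXED COMB-FP FAMILY `nFcolMix μ u ν u′ := [u = u′ ∧ μ = ν]•nFcol μ u` at `(u, u′ + e_ν)` (case split over the `ℤ⁴` test;
`biLoc_nFcol` ∕ `biLoc_zero_of_nonneg`). -/
theorem biLoc_nFcolMix (hr : r ∈ box (3 + 1) (m + 1)) {δ : ℝ} (hδ : 0 ≤ δ) (μ ν : Fin 4) (u u' : Fin 4 → ℤ) :
    BiLoc (if u = u' ∧ μ = ν then nFcol r (m + 1) μ u else 0) u (u' + unitVec ν)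
      (2 * (((3 : ℝ) + 1) * ((m + 1 : ℕ) : ℝ)) * Real.exp (δ * (4 * ((m + 1 : ℕ) : ℝ)))) δ := by
  by_cases h : u = u' ∧ μ = ν
  · rw [if_pos h, ← h.1, ← h.2]
    exact biLoc_nFcol μ u hr hδ
  · rw [if_neg h]
    exact biLoc_zero_of_nonneg u (u' + unitVec ν) (by positivity) δ

/-- [folklore] **THE «GRAM-COV» TOWER CONVERGES** along the road's tori to the `ℤ⁴` one-loop functional of the composite ghost leg against the LANDED
ghost word families `Lgh`∕`Lgh₂` (base bonds `(μ,0)`, `(ν,z)`): `KCombineCovLegs.tendsto_hessT_GPhi` at `𝒳Φ := Lgh`, `𝒳Φ₂ := Lgh₂` (`biLoc_Lgh`, `biLoc_Lgh₂`, rate `½`). -/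
theorem tendsto_gramCov_tower (ha : 0 < a) (μ ν : Fin 4) (z : Fin 4 → ℤ) {p : ℕ → ℕ} [∀ k, NeZero (p k)] (hp : Tendsto p atTop atTop) :
    Tendsto (fun k => hessT (Matrix.of (periodiseF ((m + 1) * p k) (toF (Cgh (m + 1) a))))
        (Matrix.of (periodiseF ((m + 1) * p k) (toF (arr ((m + 1) * p k) (Lgh μ 0)))))
        (Matrix.of (periodiseF ((m + 1) * p k) (toF (arr ((m + 1) * p k) (Lgh ν z)))))
        (Matrix.of (periodiseF ((m + 1) * p k) (toF (arr ((m + 1) * p k) (Lgh₂ μ 0 ν z)))))) atTop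
      (𝓝 (hessKer (Cgh (m + 1) a) (fun κ v => Lgh κ v) (fun κ v l v' => Lgh₂ κ v l v') μ ν z)) :=
  tendsto_hessT_GPhi m ha (fun κ v => Lgh κ v) (fun κ v l v' => Lgh₂ κ v l v') μ ν z (biLoc_Lgh μ 0) (biLoc_Lgh ν z) (biLoc_Lgh₂ μ 0 ν z)
    (by norm_num) hp

/-- [folklore] **THE «COMB-FP» TOWER CONVERGES** along the road's tori to the `ℤ⁴` one-loop functional of the identity leg against `nFcol`∕`nFcolMix`
(`KCombineCovCombLeg.tendsto_hessT_Gtau` at `𝒳τ := nFcol`, `𝒳τ₂ := nFcolMix`; `biLoc_nFcol`, `biLoc_nFcolMix`, rate `½`; the limit is the plain trace word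
`KCombineCovCombLeg.hessKer_idK1`). -/
theorem tendsto_combFP_tower (hr : r ∈ box (3 + 1) (m + 1)) (μ ν : Fin 4) (z : Fin 4 → ℤ) {p : ℕ → ℕ} [∀ k, NeZero (p k)]
    (hp : Tendsto p atTop atTop) :
    Tendsto (fun k => hessT (Matrix.of (periodiseF ((m + 1) * p k) (toF idK1)))
        (Matrix.of (periodiseF ((m + 1) * p k) (toF (arr ((m + 1) * p k) (nFcol r (m + 1) μ 0)))))
        (Matrix.of (periodiseF ((m + 1) * p k) (toF (arr ((m + 1) * p k) (nFcol r (m + 1) ν z)))))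
        (Matrix.of (periodiseF ((m + 1) * p k) (toF (arr ((m + 1) * p k)
          (if (0 : Fin 4 → ℤ) = z ∧ μ = ν then nFcol r (m + 1) μ 0 else 0)))))) atTop
      (𝓝 (hessKer idK1 (fun κ v => nFcol r (m + 1) κ v) (fun κ v l v' => if v = v' ∧ κ = l then nFcol r (m + 1) κ v else 0) μ ν z)) :=
  tendsto_hessT_Gtau m (fun κ v => nFcol r (m + 1) κ v) (fun κ v l v' => if v = v' ∧ κ = l then nFcol r (m + 1) κ v else 0) μ ν z
    (biLoc_nFcol μ 0 hr (by norm_num : (0 : ℝ) ≤ 1 / 2)) (biLoc_nFcol ν z hr (by norm_num : (0 : ℝ) ≤ 1 / 2))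
    (biLoc_nFcolMix m hr (by norm_num : (0 : ℝ) ≤ 1 / 2) μ ν 0 z) (by norm_num) hp

end Towers

/-! ## §3 `KCombineCov` §4 with the tower families pinned -/

section Combine

variable (m : ℕ) {a : ℝ} {r : Fin 4 → ℕ}

/-- [folklore] **«K-TA4G-COMBINE» WITH THE TOWER FAMILIES PINNED AND BOTH TOWER SOCKETS DISCHARGED**: `KCombineCovCombLeg.hessKer_transfer_road_cov_Cgh_idK1` at
`𝒳Φ := Lgh`, `𝒳Φ₂ := Lgh₂`, `𝒳τ := nFcol`, `𝒳τ₂ := nFcolMix` (their BiLoc letters supplied by `biLoc_Lgh`∕`biLoc_Lgh₂`∕`biLoc_nFcol`∕`biLoc_nFcolMix`).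
Displayed — and nothing else —: `Spr (Ga (m+1) a)`, `r ∈ box 4 (m+1)`, the M∕N families with their BiLoc letters, and the per-torus identity `hId` whose two
tower slots are now the literal torus functionals of §1 ∕ `CombFPWordArrays.hessT_combFP_What0_eq_arr`. -/
theorem hessKer_transfer_road_cov_towers (ha : 0 < a) (hGa : Spr (GluonLeg.Ga (m + 1) a)) (hr : r ∈ box (3 + 1) (m + 1))
    (𝒱M : Fin 4 → (Fin 4 → ℤ) → MKer 4 (Fib 3)) (𝒲M : Fin 4 → (Fin 4 → ℤ) → Fin 4 → (Fin 4 → ℤ) → MKer 4 (Fib 3))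
    (𝒱N : Fin 4 → (Fin 4 → ℤ) → MKer 4 (Fib 3)) (𝒲N : Fin 4 → (Fin 4 → ℤ) → Fin 4 → (Fin 4 → ℤ) → MKer 4 (Fib 3))
    (μ ν : Fin 4) (z : Fin 4 → ℤ)
    {PM PM' QM QM' PN PN' QN QN' : Fin 4 → ℤ} {CvM CvM' CM δM CvN CvN' CN δN : ℝ}
    (hVM : BiLoc (𝒱M μ 0) PM PM' CvM δM) (hVM' : BiLoc (𝒱M ν z) QM' QM CvM' δM) (hWM : BiLoc (𝒲M μ 0 ν z) PM QM CM δM) (hδM : 0 < δM)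
    (hVN : BiLoc (𝒱N μ 0) PN PN' CvN δN) (hVN' : BiLoc (𝒱N ν z) QN' QN CvN' δN) (hWN : BiLoc (𝒲N μ 0 ν z) PN QN CN δN) (hδN : 0 < δN)
    {p : ℕ → ℕ} [∀ k, NeZero (p k)] (hp : Tendsto p atTop atTop)
    (hId : ∀ k,
      hessT (blocksHat (p k) (sortK (m + 1) (coDressKBmAt (toSite r) (m + 1) (KInvStep (d := 3) (m + 1) 0))))
          (blocksHat (p k) (sortK (m + 1) (arr ((m + 1) * p k) (𝒱M μ 0))))
          (blocksHat (p k) (sortK (m + 1) (arr ((m + 1) * p k) (𝒱M ν z))))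
          (blocksHat (p k) (sortK (m + 1) (arr ((m + 1) * p k) (𝒲M μ 0 ν z))))
        + hessT (Matrix.of (periodiseF ((m + 1) * p k) (toF (Cgh (m + 1) a))))
          (Matrix.of (periodiseF ((m + 1) * p k) (toF (arr ((m + 1) * p k) (Lgh μ 0)))))
          (Matrix.of (periodiseF ((m + 1) * p k) (toF (arr ((m + 1) * p k) (Lgh ν z)))))
          (Matrix.of (periodiseF ((m + 1) * p k) (toF (arr ((m + 1) * p k) (Lgh₂ μ 0 ν z)))))
      = hessT (blocksHat (p k) (sortK (m + 1) (NlegRoad m a)))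
          (blocksHat (p k) (sortK (m + 1) (arr ((m + 1) * p k) (𝒱N μ 0))))
          (blocksHat (p k) (sortK (m + 1) (arr ((m + 1) * p k) (𝒱N ν z))))
          (blocksHat (p k) (sortK (m + 1) (arr ((m + 1) * p k) (𝒲N μ 0 ν z))))
        + 2 * hessT (Matrix.of (periodiseF ((m + 1) * p k) (toF idK1)))
          (Matrix.of (periodiseF ((m + 1) * p k) (toF (arr ((m + 1) * p k) (nFcol r (m + 1) μ 0)))))
          (Matrix.of (periodiseF ((m + 1) * p k) (toF (arr ((m + 1) * p k) (nFcol r (m + 1) ν z)))))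
          (Matrix.of (periodiseF ((m + 1) * p k) (toF (arr ((m + 1) * p k)
            (if (0 : Fin 4 → ℤ) = z ∧ μ = ν then nFcol r (m + 1) μ 0 else 0)))))) :
    hessKer (coDressKBmAt (toSite r) (m + 1) (KInvStep (d := 3) (m + 1) 0)) 𝒱M 𝒲M μ ν z
        + hessKer (Cgh (m + 1) a) (fun κ v => Lgh κ v) (fun κ v l v' => Lgh₂ κ v l v') μ ν z
      = hessKer (NlegRoad m a) 𝒱N 𝒲N μ ν z
        + 2 * hessKer idK1 (fun κ v => nFcol r (m + 1) κ v) (fun κ v l v' => if v = v' ∧ κ = l then nFcol r (m + 1) κ v else 0) μ ν z :=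
  hessKer_transfer_road_cov_Cgh_idK1 m ha hGa hr 𝒱M 𝒲M 𝒱N 𝒲N (fun κ v => Lgh κ v) (fun κ v l v' => Lgh₂ κ v l v')
    (fun κ v => nFcol r (m + 1) κ v) (fun κ v l v' => if v = v' ∧ κ = l then nFcol r (m + 1) κ v else 0) μ ν z
    hVM hVM' hWM hδM hVN hVN' hWN hδN (biLoc_Lgh μ 0) (biLoc_Lgh ν z) (biLoc_Lgh₂ μ 0 ν z) (by norm_num)
    (biLoc_nFcol μ 0 hr (by norm_num : (0 : ℝ) ≤ 1 / 2)) (biLoc_nFcol ν z hr (by norm_num : (0 : ℝ) ≤ 1 / 2))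
    (biLoc_nFcolMix m hr (by norm_num : (0 : ℝ) ≤ 1 / 2) μ ν 0 z) (by norm_num) hp hId

end Combine

end Summit.QuantumFields.BalabanUV.Beta.D1BFx.KCombineCovTowers

end
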